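import Summits.SmoothPoincare4.SmoothPoincare4.Theorems.ConvexBisectionAcyclicBisectionExistsCrossingSymmetry
import Summits.SmoothPoincare4.SmoothPoincare4.Theorems.ConvexBisectionAcyclicBisectionExistsChartedChainAssembly
import Summits.SmoothPoincare4.SmoothPoincare4.Theorems.ConvexBisectionAcyclicBisectionExistsStdSympChain
import HarnessLib

/-!
# The missing lemma of node N1a: the crossing number is the standard symplectic pairing of shadows
(wave 5, brick X7-4 = the missing lemma `crossingNumber_eq_stdSymp` (V7-REPORT §3 verbatim) of
node N1a `node_M3c_shadow_pageDehnTwist` of stub `stub_modelsOnFibred_of_reach` = NF4, line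
`modp-braid-orbits`, crux `ConvexBisection.AcyclicBisectionExists`, item stmt-SmoothPoincare4-10508;
registered sub-goal `helper_crossingNumber_eq_stdSymp`)

For a page curve `a` of `page g c` (`‖c‖ = 1`) with an annulus chart `φ` satisfying the six
hypotheses of node N1a and every loop `K` of that page,

  **`crossingNumber φ K = stdSymp ℤ g (shadow g a) (shadow g K)`**  (`crossingNumber_eq_stdSymp`).

This is the Lean-checked assembly of Z6-REPORT §3 / Y4-REPORT §0 made unconditional: the charted
model chain `(b j, ψ j)` of the page (`exists_charted_chain`, (R2), Y4-5) realises the chain basis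
`chainVec g` with the `A_{2g}` crossing pattern, so the crossing functional of each model chart is
`stdSymp (chainVec j) ·` (`crossingNumber_eq_stdSymp_of_chainVec`, `stdSymp_chainVec_chainVec`,
Z6-3/Z6-7); the symmetry (R1) `crossingNumber_symm` (X7-3) evaluates the crossing functional of
the ARBITRARY chart `φ` on the chain: `crossingNumber φ (b j) = −crossingNumber (ψ j) a =
−stdSymp (chainVec j) (shadow a) = stdSymp (shadow a) (chainVec j)`; and
`crossingNumber_eq_stdSymp_of_chainVec` concludes.
Everything is proved; no definitions, no named facts, no `sorry`.  References: B. Farb,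
D. Margalit, *A primer on mapping class groups* (2012), Prop. 6.3 [FarbMargalit2012];
V. I. Arnold, S. M. Gusein-Zade, A. N. Varchenko, *Singularities of Differentiable Maps II* (1988),
§2 (the `A_{2g}` intersection form of the Milnor fibre) [AGZV1988].
-/

noncomputable section

set_option linter.dupNamespace false

open scoped Manifold ContDiff Topology Real
open Set Function Metric
open Literature.Topology.FourManifolds Literature.Topology.FourManifolds.LefschetzBase
  Literature.GroupTheory.CombinatorialGroupTheory.SignedHurwitz

namespace Summit.SmoothPoincare4.SmoothPoincare4.Theorems.AcyclicBisectionExists.ModpBraidOrbits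

variable {g : ℕ} {c : ℂ} {φ : ℝ × ℝ → Base g}
  {a K : sphere (0 : EuclideanSpace ℝ (Fin 2)) 1 → Base g}

/-- **The missing lemma of node N1a: `crossingNumber φ K = stdSymp ℤ g (shadow a) (shadow K)`**
for a page curve `a` with an annulus chart `φ` satisfying the six hypotheses of node N1a and every
loop `K` of the page (V7-REPORT §3). [cite: FarbMargalit2012, Prop. 6.3] -/
theorem crossingNumber_eq_stdSymp (hc : ‖c‖ = 1) (ha : Continuous a)
    (hφs : ContMDiff 𝓘(ℝ, ℝ × ℝ) (𝓡∂ 4) ∞ φ) (hφ1 : ∀ u r, φ (u + 1, r) = φ (u, r))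
    (hφa : ∀ u, φ (u, 0) = a (circlePt u)) (hφp : ∀ p, φ p ∈ page g c)
    (hφi : InjOn φ (Ico (0 : ℝ) 1 ×ˢ Ioo (-1 : ℝ) 1))
    (hφo : ∀ u r, r ∈ Ioo (-1 : ℝ) 1 →
      0 < inner ℝ (deriv (fun r' => (φ (u, r')).1) r) (cplxJ (deriv (fun u' => (φ (u', r)).1) u)))
    (hK : Continuous K) (hKc : ∀ θ, K θ ∈ page g c) :
    crossingNumber φ K = stdSymp ℤ g (shadow g a ha) (shadow g K hK) := by
  obtain ⟨b, ψ, hb, hch, hsh, hcn⟩ := exists_charted_chain g c hc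
  have hbc : ∀ i θ, b i θ ∈ page g c := fun i => core_mem_page (hch i).2.2.1 (hch i).2.2.2.1
  -- the crossing functional of each model chart is `stdSymp (chainVec i) ·`
  have hmodel : ∀ i : Fin (2 * g), crossingNumber (ψ i) a =
      stdSymp ℤ g (chainVec g i) (shadow g a ha) := fun i =>
    crossingNumber_eq_stdSymp_of_chainVec hc (hch i).1.continuous (hch i).2.1 (hch i).2.2.2.1
      (hch i).2.2.2.2.1 (chainVec g i) b hb hbc hsh (fun j => by
        rw [hcn i j, stdSymp_chainVec_chainVec i.2 j.2]) ha (core_mem_page hφa hφp)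
  -- evaluation of the crossing functional of `φ` on the chain, by the symmetry (R1)
  have hval : ∀ i : Fin (2 * g), crossingNumber φ (b i) = stdSymp ℤ g (shadow g a ha) (chainVec g i) := by
    intro i
    rw [crossingNumber_symm hc ha (hb i) hφs hφ1 hφa hφp hφi hφo (hch i).1 (hch i).2.1 (hch i).2.2.1
      (hch i).2.2.2.1 (hch i).2.2.2.2.1 (hch i).2.2.2.2.2, hmodel i, stdSymp_int_swap]
    ring
  exact crossingNumber_eq_stdSymp_of_chainVec hc hφs.continuous hφ1 hφp hφi (shadow g a ha) b hb
    hbc hsh hval hK hKc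

/-! ## The registered form -/

/-- **Sub-goal `helper_crossingNumber_eq_stdSymp`** (X7-4, the missing lemma of node N1a of NF4 in
the exact form of V7-REPORT §3): the crossing number of a page loop `K` with the framed page curve
`a` presented by a positively oriented smooth annulus chart `φ` of `page g c` is the standard
symplectic pairing of the homology shadows, `stdSymp ℤ g (shadow a) (shadow K)`.
[cite: FarbMargalit2012, Prop. 6.3] -/
theorem helper_crossingNumber_eq_stdSymp : ∀ (g : ℕ) (c : ℂ) (_hc : ‖c‖ = 1) (a : Metric.sphere (0 : EuclideanSpace ℝ (Fin 2)) 1 → Literature.Topology.FourManifolds.LefschetzBase.Base g) (ha : Continuous a) (φ : ℝ × ℝ → Literature.Topology.FourManifolds.LefschetzBase.Base g) (_hφs : ContMDiff 𝓘(ℝ, ℝ × ℝ) (𝓡∂ 4) ∞ φ) (_hφ1 : ∀ u r, φ (u + 1, r) = φ (u, r)) (_hφa : ∀ u, φ (u, 0) = a (Literature.Topology.FourManifolds.circlePt u)) (_hφp : ∀ p, φ p ∈ Literature.Topology.FourManifolds.LefschetzBase.page g c) (_hφi : Set.InjOn φ (Set.Ico (0 : ℝ) 1 ×ˢ Set.Ioo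 (-1 : ℝ) 1)) (_hφo : ∀ u r, r ∈ Set.Ioo (-1 : ℝ) 1 → 0 < inner ℝ (deriv (fun r' => (φ (u, r')).1) r) (Literature.Topology.FourManifolds.LefschetzBase.cplxJ (deriv (fun u' => (φ (u', r)).1) u))) (K : Metric.sphere (0 : EuclideanSpace ℝ (Fin 2)) 1 → Literature.Topology.FourManifolds.LefschetzBase.Base g) (hK : Continuous K) (_hKc : ∀ θ, K θ ∈ Literature.Topology.FourManifolds.LefschetzBase.page g c), Summit.SmoothPoincare4.SmoothPoincare4.Theorems.AcyclicBisectionExists.ModpBraidOrbits.crossingNumber φ K = Literature.GroupTheory.CombinatorialGroupTheory.SignedHurwitz.stdSymp ℤ g (Literature.Topology.FourManifolds.LefschetzBase.shadow g a ha) (Literature.Topology.FourManifolds.LefschetzBase.shadow g K hK) :=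
  fun _ _ hc _ ha _ hφs hφ1 hφa hφp hφi hφo _ hK hKc =>
    crossingNumber_eq_stdSymp hc ha hφs hφ1 hφa hφp hφi hφo hK hKc

end Summit.SmoothPoincare4.SmoothPoincare4.Theorems.AcyclicBisectionExists.ModpBraidOrbits

end
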